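import Mathlib

/-!
# An injective Marica–Schönheim theorem via minimum-gap batches

Helper file for crux `stmt-CriticalPhenomena-4575` (`NoHeavyLowerTail`, route `PercNearOneGluingNoHeavy`),
factory seat `prim-ineq-gen-3` (gen 4); companion of
`PercNearOneGluingNoHeavyLowerTailSeparatedDifferences` and `…OrientedAntipodalHallChain`.

**Theorem A** (`exists_injOn_mem_subset_of_diffs_subset`).  Let `𝒵` be a finite family of finite sets and
`ℰ ⊇ 𝒵 \\ 𝒵` any family containing all pairwise differences ("pool").  Then there is a map `f`, injective
on `𝒵`, with `f Z ∈ ℰ` and `f Z ⊆ Z` for every `Z ∈ 𝒵`.  In particular (`exists_injOn_diffs`) every family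
injects into its difference family along `⊆`, an injective form of the Marica–Schönheim inequality
`#𝒵 ≤ #(𝒵 \\ 𝒵)` (Mathlib: `Finset.card_le_card_diffs`, proved there via the four functions theorem).

Proof (min-gap batches, after Daykin–Hilton–Miklós' proof of Berge's pairing theorem): among all pairs
`(Z, T)` with `Z ∈ 𝒵`, `T ∈ ℰ`, `T ⊆ Z` pick one minimising the gap `#(Z \ T)` and put `E := Z \ T`; the batch
of all `Z ⊇ E` with `Z \ E ∈ ℰ` is sent to `Z ↦ Z \ E` (injective), and the *closure lemma*
(`diffs_sdiff_batch_subset`) shows that the remaining family still has all its differences in the remaining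
pool, so one recurses.  This is the one-family case of the greedy that is conjectured (memo
`run/shared/lean/prim/prim-ineq-gen-3/COMB.md` §3c (xv)) to prove the two-family inequality `MS2′` needed by
`OrientedAntipodalHall.card_add_card_le_card_goods_above_chain`.  (prim-ineq-gen-3 gen 4, 2026-08-20.)
-/

namespace Summit.CriticalPhenomena.PercolationContinuityZ3.Theorems

namespace TwoFamilyDifferences

open Finset
open scoped FinsetFamily

variable {α : Type*} [DecidableEq α]

/-- **Closure lemma for a minimum-gap batch.**  Let `𝒵 \\ 𝒵 ⊆ ℰ`, let `E` be a set such that every pair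
`Z ∈ 𝒵`, `T ∈ ℰ` with `T ⊆ Z` has `#E ≤ #(Z \ T)` (minimum gap), and let
`ℬ = {Z ∈ 𝒵 | E ⊆ Z ∧ Z \ E ∈ ℰ}` be the batch.  Then the differences of the remaining family `𝒵 \ ℬ` avoid
the images `Z \ E` (`Z ∈ ℬ`), i.e. they lie in the remaining pool. -/
theorem diffs_sdiff_batch_subset (𝒵 ℰ : Finset (Finset α)) (E : Finset α) (hsub : 𝒵 \\ 𝒵 ⊆ ℰ)
    (hmin : ∀ Z ∈ 𝒵, ∀ T ∈ ℰ, T ⊆ Z → #E ≤ #(Z \ T)) :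
    (𝒵 \ {Z ∈ 𝒵 | E ⊆ Z ∧ Z \ E ∈ ℰ}) \\ (𝒵 \ {Z ∈ 𝒵 | E ⊆ Z ∧ Z \ E ∈ ℰ}) ⊆
      ℰ \ ({Z ∈ 𝒵 | E ⊆ Z ∧ Z \ E ∈ ℰ}.image fun Z => Z \ E) := by
  intro T hT
  obtain ⟨Z, hZ, Z', hZ', rfl⟩ := mem_diffs.mp hT
  rw [mem_sdiff] at hZ hZ'
  obtain ⟨hZ, -⟩ := hZ
  obtain ⟨hZ', hZ'b⟩ := hZ'
  have hTℰ : Z \ Z' ∈ ℰ := hsub (mem_diffs.mpr ⟨Z, hZ, Z', hZ', rfl⟩)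
  refine mem_sdiff.mpr ⟨hTℰ, ?_⟩
  intro himg
  obtain ⟨Z'', hZ''b, hEq⟩ := mem_image.mp himg
  rw [mem_filter] at hZ''b
  obtain ⟨hZ'', hEZ'', hZ''E⟩ := hZ''b
  -- `Z'' ⊆ (Z \ Z') ∪ E`, hence `Z' ∩ Z'' ⊆ E`
  have hcap : Z' ∩ Z'' ⊆ E := by
    intro x hx
    rw [mem_inter] at hx
    by_contra hxE
    have hx' : x ∈ Z'' \ E := mem_sdiff.mpr ⟨hx.2, hxE⟩
    rw [hEq, mem_sdiff] at hx'
    exact hx'.2 hx.1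
  -- the pair `(Z', Z' \ Z'')` has gap `Z' ∩ Z''`, so by minimality `#E ≤ #(Z' ∩ Z'')`
  have hdiff : Z' \ Z'' ∈ ℰ := hsub (mem_diffs.mpr ⟨Z', hZ', Z'', hZ'', rfl⟩)
  have hle : #E ≤ #(Z' ∩ Z'') := by
    have := hmin Z' hZ' (Z' \ Z'') hdiff sdiff_subset
    rwa [sdiff_sdiff_right_self] at this
  have hEeq : Z' ∩ Z'' = E := eq_of_subset_of_card_le hcap hle
  have hEZ' : E ⊆ Z' := hEeq ▸ inter_subset_left
  have hZ'E : Z' \ E = Z' \ Z'' := by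
    rw [← hEeq]
    ext x
    simp only [mem_sdiff, mem_inter, not_and]
    constructor
    · rintro ⟨hx, h⟩; exact ⟨hx, h hx⟩
    · rintro ⟨hx, h⟩; exact ⟨hx, fun _ => h⟩
  -- hence `Z'` belongs to the batch, contradiction
  exact hZ'b (mem_filter.mpr ⟨hZ', hEZ', hZ'E ▸ hdiff⟩)

/-- **Theorem A** (injective Marica–Schönheim with a pool), cardinality-indexed form used for the
induction. -/
theorem exists_injOn_mem_subset_of_diffs_subset_aux (k : ℕ) :
    ∀ 𝒵 ℰ : Finset (Finset α), #𝒵 = k → 𝒵 \\ 𝒵 ⊆ ℰ →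
      ∃ f : Finset α → Finset α, Set.InjOn f ↑𝒵 ∧ ∀ Z ∈ 𝒵, f Z ∈ ℰ ∧ f Z ⊆ Z := by
  induction k using Nat.strong_induction_on with
  | _ k ih =>
  intro 𝒵 ℰ hk hsub
  rcases 𝒵.eq_empty_or_nonempty with h𝒵 | ⟨Z₀, hZ₀⟩
  · exact ⟨id, by simp [h𝒵], by simp [h𝒵]⟩
  -- admissible pairs `(Z, T)` : `T ∈ ℰ`, `T ⊆ Z`
  set P : Finset (Finset α × Finset α) := (𝒵 ×ˢ ℰ).filter fun p => p.2 ⊆ p.1 with hP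
  have hP0 : (Z₀, ∅) ∈ P := by
    rw [hP, mem_filter, mem_product]
    exact ⟨⟨hZ₀, hsub (mem_diffs.mpr ⟨Z₀, hZ₀, Z₀, hZ₀, by simp⟩)⟩, empty_subset _⟩
  obtain ⟨p₀, hp₀, hp₀min⟩ := P.exists_min_image (fun p => #(p.1 \ p.2)) ⟨_, hP0⟩
  rw [hP, mem_filter, mem_product] at hp₀
  obtain ⟨⟨hp₀Z, hp₀E⟩, hp₀sub⟩ := hp₀
  set E : Finset α := p₀.1 \ p₀.2 with hE
  have hmin : ∀ Z ∈ 𝒵, ∀ T ∈ ℰ, T ⊆ Z → #E ≤ #(Z \ T) := by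
    intro Z hZ T hT hTZ
    have := hp₀min (Z, T) (by rw [hP, mem_filter, mem_product]; exact ⟨⟨hZ, hT⟩, hTZ⟩)
    simpa [hE] using this
  -- the batch
  set ℬ : Finset (Finset α) := {Z ∈ 𝒵 | E ⊆ Z ∧ Z \ E ∈ ℰ} with hℬ
  have hℬsub : ℬ ⊆ 𝒵 := filter_subset _ _
  have hp₀ℬ : p₀.1 ∈ ℬ := by
    rw [hℬ, mem_filter]
    refine ⟨hp₀Z, sdiff_subset, ?_⟩
    have h12 : p₀.1 \ E = p₀.2 := by
      rw [hE, sdiff_sdiff_right_self]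
      exact inf_eq_right.mpr hp₀sub
    rw [h12]
    exact hp₀E
  -- the remaining instance
  set 𝒵' := 𝒵 \ ℬ with h𝒵'
  set ℰ' := ℰ \ ℬ.image (fun Z => Z \ E) with hℰ'
  have hcard : #𝒵' < k := by
    rw [h𝒵', card_sdiff_of_subset hℬsub, ← hk]
    have : 0 < #ℬ := card_pos.mpr ⟨_, hp₀ℬ⟩
    have : #ℬ ≤ #𝒵 := card_le_card hℬsub
    omega
  have hsub' : 𝒵' \\ 𝒵' ⊆ ℰ' := by
    rw [h𝒵', hℰ', hℬ]
    exact diffs_sdiff_batch_subset 𝒵 ℰ E hsub hmin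
  obtain ⟨f', hf'inj, hf'⟩ := ih _ hcard 𝒵' ℰ' rfl hsub'
  -- glue
  refine ⟨fun Z => if Z ∈ ℬ then Z \ E else f' Z, ?_, ?_⟩
  · intro Z₁ hZ₁ Z₂ hZ₂ hEqf
    simp only [Finset.mem_coe] at hZ₁ hZ₂
    by_cases h₁ : Z₁ ∈ ℬ <;> by_cases h₂ : Z₂ ∈ ℬ
    · simp only [h₁, h₂, if_true] at hEqf
      have e₁ : E ⊆ Z₁ := ((mem_filter.mp h₁).2).1
      have e₂ : E ⊆ Z₂ := ((mem_filter.mp h₂).2).1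
      rw [← sdiff_union_of_subset e₁, ← sdiff_union_of_subset e₂, hEqf]
    · simp only [h₁, h₂, if_true, if_false] at hEqf
      have hZ₂' : Z₂ ∈ 𝒵' := mem_sdiff.mpr ⟨hZ₂, h₂⟩
      have := (hf' Z₂ hZ₂').1
      rw [hℰ', mem_sdiff] at this
      exact absurd (mem_image.mpr ⟨Z₁, h₁, hEqf⟩) this.2
    · simp only [h₁, h₂, if_true, if_false] at hEqf
      have hZ₁' : Z₁ ∈ 𝒵' := mem_sdiff.mpr ⟨hZ₁, h₁⟩
      have := (hf' Z₁ hZ₁').1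
      rw [hℰ', mem_sdiff] at this
      exact absurd (mem_image.mpr ⟨Z₂, h₂, hEqf.symm⟩) this.2
    · simp only [h₁, h₂, if_false] at hEqf
      exact hf'inj (mem_coe.mpr (mem_sdiff.mpr ⟨hZ₁, h₁⟩)) (mem_coe.mpr (mem_sdiff.mpr ⟨hZ₂, h₂⟩)) hEqf
  · intro Z hZ
    by_cases h : Z ∈ ℬ
    · simp only [h, if_true]
      exact ⟨((mem_filter.mp h).2).2, sdiff_subset⟩
    · simp only [h, if_false]
      have hZ' : Z ∈ 𝒵' := mem_sdiff.mpr ⟨hZ, h⟩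
      obtain ⟨h1, h2⟩ := hf' Z hZ'
      rw [hℰ', mem_sdiff] at h1
      exact ⟨h1.1, h2⟩

/-- **Theorem A** (injective Marica–Schönheim with a pool).  If a family `ℰ` contains every difference
`Z \ Z'` of members of `𝒵`, then `𝒵` injects into `ℰ` along `⊆`: there is `f`, injective on `𝒵`, with
`f Z ∈ ℰ` and `f Z ⊆ Z` for all `Z ∈ 𝒵`. -/
theorem exists_injOn_mem_subset_of_diffs_subset (𝒵 ℰ : Finset (Finset α)) (hsub : 𝒵 \\ 𝒵 ⊆ ℰ) :
    ∃ f : Finset α → Finset α, Set.InjOn f ↑𝒵 ∧ ∀ Z ∈ 𝒵, f Z ∈ ℰ ∧ f Z ⊆ Z :=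
  exists_injOn_mem_subset_of_diffs_subset_aux #𝒵 𝒵 ℰ rfl hsub

/-- **Injective Marica–Schönheim.**  Every finite family of finite sets injects into its own difference
family along `⊆`. -/
theorem exists_injOn_diffs (𝒵 : Finset (Finset α)) :
    ∃ f : Finset α → Finset α, Set.InjOn f ↑𝒵 ∧ ∀ Z ∈ 𝒵, f Z ∈ 𝒵 \\ 𝒵 ∧ f Z ⊆ Z :=
  exists_injOn_mem_subset_of_diffs_subset 𝒵 (𝒵 \\ 𝒵) Subset.rfl

/-- The Marica–Schönheim inequality with a pool, as a cardinality statement: if `ℰ ⊇ 𝒵 \\ 𝒵` then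
`#𝒵 ≤ #{T ∈ ℰ | ∃ Z ∈ 𝒵, T ⊆ Z}` (only pool members lying below some member of `𝒵` are needed). -/
theorem card_le_card_filter_pool_of_diffs_subset (𝒵 ℰ : Finset (Finset α)) (hsub : 𝒵 \\ 𝒵 ⊆ ℰ) :
    #𝒵 ≤ #{T ∈ ℰ | ∃ Z ∈ 𝒵, T ⊆ Z} := by
  obtain ⟨f, hinj, hf⟩ := exists_injOn_mem_subset_of_diffs_subset 𝒵 ℰ hsub
  refine card_le_card_of_injOn f (fun Z hZ => ?_) hinj
  rw [mem_coe, mem_filter]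
  exact ⟨(hf Z hZ).1, Z, hZ, (hf Z hZ).2⟩

end TwoFamilyDifferences

end Summit.CriticalPhenomena.PercolationContinuityZ3.Theorems
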